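import Summits.MatrixMultiplication.MatrixMultiplication.Theorems.SaturationLadderLittleCwGibbs
import HarnessLib

/-!
# Route `SaturationLadder` — the level-1 value of a MATRIX–VECTOR base never meets the information bound
# (decomp-mm lens 1 «grading / quantitative ladder», gen 39; support helper beneath crux `SubexpSaturation`,
# stmt-MatrixMultiplication-25909; companion of `SaturationLadderLittleCwGibbs` and `SaturationLadderStrictlyAbundantBase`)

PROVED, 0 sorry; pure real analysis on explicit functions; no definitions, no instances, no named facts.

SETTING (memo `decomp-mm-lens-1/gen39/NODE-SaturationLadder-g39.md` §2).  The strictly abundant base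
`T₆ = T_(2)` of `SaturationLadderStrictlyAbundantBase` and its family `T_(g)` (`G = K^g`, `H = (G ⊗ G)^*`,
format `m = g² + g = R̲(T_(g))`) have, in the coarse blocking `{G, H}` of each leg, the tight three-point
support `{(H,G,G), (G,H,G), (G,G,H)}` of the little Coppersmith–Winograd tensor, but with MATRIX–VECTOR blocks
`⟨g,g,1⟩, ⟨1,g,g⟩, ⟨g,1,g⟩` in place of `cw_q`'s vector blocks `⟨1,1,q⟩, ⟨q,1,1⟩, ⟨1,q,1⟩`.  The first-power
laser certificate with block law `(p₁,p₂,p₃)` reaches the shape exponents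
`(e,h,l) = (p₁+p₃, p₁+p₂, p₂+p₃)·log g` with `|Δ| ≐ exp(N·min_i h(p_i))` diagonal triples, so its value per
coordinate, measured against the flattening lower bound `max(e+h, h+l, e+l) = (1 + max_i p_i)·log g`, is governed
by the functional
  `Φ_g(p) := min_i h(p_i) + (1 + max_i p_i)·log g`   versus   `log R̲ = log(g² + g)`:
the certificate is exactly tight at `p` iff `Φ_g(p) = log(g² + g)`.

THE THEOREMS.
* `binEntropy_add_two_mul_log_le` — the symmetric Gibbs inequality `h(x) + (2 − 2x)·log g ≤ log(g² + 1)` on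
  `[0,1]` (`g > 0`): `SaturationLadderLittleCwGibbs.binEntropy_add_mul_log_le` at `q = g²`;
* `levelOneValue_le` — **`Φ_g(p) ≤ log(g² + 1)`** for every law `p` on the three blocks (`g ≥ 1`): the minimum
  entropy is at most `h(min p)`, the maximum is at most `1 − 2·min p`, then Gibbs;
* `levelOneValue_eq_at_gibbsPoint` — the bound is ATTAINED at `p = (1 − 2x⋆, x⋆, x⋆)`, `x⋆ = 1/(g²+1)` (`g ≥ 2`,
  so that `2x⋆ ≤ 1/2` and `h(1 − 2x⋆) = h(2x⋆) ≥ h(x⋆)` by `Real.binEntropy_strictMonoOn`): `sup Φ_g = log(g²+1)`;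
* `log_sq_add_one_lt_log_borderRank` — `log(g² + 1) < log(g² + g)` (`g > 1`), whence
* `levelOneValue_lt_log_borderRank` — **`Φ_g(p) < log(g² + g)` for every `p`**: the level-1 certificate of
  `T_(g)` certifies NO exactly tight shape, for any `g ≥ 2`; the uniform defect is `log((g²+g)/(g²+1))`
  (`T₆`: `log(6/5)`, numerically the defect of little `cw₄`);
* `pairSums_max_le_half` / `thin_far_not_balanced` — the shape geometry: the three pair sums satisfy
  `2·max(e,h,l) ≤ e+h+l`, while a thin shape `s·(1,t,r)` with `r > 1 + t` has `2·(s r) > s + s t + s r`; so the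
  far edge `r → ∞` of crux `SubexpSaturation` is not even ADDRESSED by matrix–vector blocks at level 1 — read
  together with the slice-corank screen of the memo (§1: every slice of `T_(g)` has rank `≤ 2g = m − (g² − g)` on
  every leg, so no blocking of any power carries a fuel letter of length `m − O(1)`), the family `T_(g)` exits the
  unique-usage map of item 25909 and `T₆` remains an isolated corank-2 point.
A statement about the VALUE of one certificate (first power, coarse blocking), not about `ω`; exactly as for
`SaturationLadderLittleCwGibbs`.  Numerical cross-check (grid `1/900` on the simplex, `g = 2..6`):
`gen39/probe-g39.txt` part (A).
[cite: CoppersmithWinograd1990, §6; BurgisserClausenShokrollahi1997, Thm. 15.41; CoverThomas2006, Thm. 2.6.3;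
JelisiejewLandsbergPal2023, §1.4.1]
-/

set_option linter.dupNamespace false

noncomputable section

namespace Summit.MatrixMultiplication.MatrixMultiplication.Theorems.SaturationLadderMatrixVectorGibbs

open Summit.MatrixMultiplication.MatrixMultiplication.Theorems.SaturationLadderLittleCwGibbs
  (binEntropy_add_mul_log_le binEntropy_add_mul_log_eq_iff)

/-- Symmetric Gibbs inequality: `h(x) + (2 − 2x) log g ≤ log(g² + 1)` for `x ∈ [0,1]`, `g > 0` — the little-CW
Gibbs inequality `h(p) + (1 − p) log q ≤ log(q + 1)` at `q = g²`. [cite: CoverThomas2006, Thm. 2.6.3] -/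
theorem binEntropy_add_two_mul_log_le {x g : ℝ} (hx0 : 0 ≤ x) (hx1 : x ≤ 1) (hg : 0 < g) :
    Real.binEntropy x + (2 - 2 * x) * Real.log g ≤ Real.log (g ^ 2 + 1) := by
  have h := binEntropy_add_mul_log_le hx0 hx1 (q := g ^ 2) (by positivity)
  have hlog : Real.log (g ^ 2) = 2 * Real.log g := by
    rw [Real.log_pow]; push_cast; ring
  rw [hlog] at h
  linarith

/-- Equality case of the symmetric Gibbs inequality: at `x = 1/(g² + 1)` (`g ≥ 1`).
[cite: CoverThomas2006, Thm. 2.6.3] -/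
theorem binEntropy_add_two_mul_log_eq {g : ℝ} (hg : 1 ≤ g) :
    Real.binEntropy (1 / (g ^ 2 + 1)) + (2 - 2 * (1 / (g ^ 2 + 1))) * Real.log g = Real.log (g ^ 2 + 1) := by
  have hg2 : 1 ≤ g ^ 2 := by nlinarith
  have hx0 : 0 ≤ 1 / (g ^ 2 + 1) := by positivity
  have hx1 : 1 / (g ^ 2 + 1) ≤ 1 := by
    rw [div_le_one (by positivity)]
    linarith
  have h := (binEntropy_add_mul_log_eq_iff hx0 hx1 hg2).2 rfl
  have hlog : Real.log (g ^ 2) = 2 * Real.log g := by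
    rw [Real.log_pow]; push_cast; ring
  rw [hlog] at h
  linarith

/-- The reduction step: if `Hmin ≤ h(x)` and `M ≤ 1 − 2x` with `x ∈ [0,1]`, `g ≥ 1`, then
`Hmin + (1 + M) log g ≤ log(g² + 1)`. [folklore] -/
theorem value_le_of_min_le {g x M Hmin : ℝ} (hg : 1 ≤ g) (hx0 : 0 ≤ x) (hx1 : x ≤ 1)
    (hH : Hmin ≤ Real.binEntropy x) (hM : M ≤ 1 - 2 * x) :
    Hmin + (1 + M) * Real.log g ≤ Real.log (g ^ 2 + 1) := by
  have hlog : 0 ≤ Real.log g := Real.log_nonneg hg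
  have hG := binEntropy_add_two_mul_log_le (g := g) hx0 hx1 (by linarith)
  have hmul : (1 + M) * Real.log g ≤ (2 - 2 * x) * Real.log g :=
    mul_le_mul_of_nonneg_right (by linarith) hlog
  linarith

/-- **The level-1 value bound.**  For every law `(p₁,p₂,p₃)` on the three matrix–vector blocks of `T_(g)`
(`g ≥ 1`):  `min_i h(p_i) + (1 + max_i p_i)·log g ≤ log(g² + 1)`.
[cite: CoppersmithWinograd1990, §6] [cite: CoverThomas2006, Thm. 2.6.3] -/
theorem levelOneValue_le {g p₁ p₂ p₃ : ℝ} (hg : 1 ≤ g) (h1 : 0 ≤ p₁) (h2 : 0 ≤ p₂) (h3 : 0 ≤ p₃)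
    (hs : p₁ + p₂ + p₃ = 1) :
    min (Real.binEntropy p₁) (min (Real.binEntropy p₂) (Real.binEntropy p₃))
      + (1 + max p₁ (max p₂ p₃)) * Real.log g ≤ Real.log (g ^ 2 + 1) := by
  -- pick the smallest of the three coordinates
  rcases le_total p₁ p₂ with h12 | h21
  · rcases le_total p₁ p₃ with h13 | h31
    · -- p₁ is the minimum
      refine value_le_of_min_le hg h1 (by linarith) (min_le_left _ _) ?_
      exact max_le (by linarith) (max_le (by linarith) (by linarith))
    · -- p₃ ≤ p₁ ≤ p₂ : p₃ is the minimum
      refine value_le_of_min_le hg h3 (by linarith) ((min_le_right _ _).trans (min_le_right _ _)) ?_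
      exact max_le (by linarith) (max_le (by linarith) (by linarith))
  · rcases le_total p₂ p₃ with h23 | h32
    · -- p₂ is the minimum
      refine value_le_of_min_le hg h2 (by linarith) ((min_le_right _ _).trans (min_le_left _ _)) ?_
      exact max_le (by linarith) (max_le (by linarith) (by linarith))
    · -- p₃ ≤ p₂ ≤ p₁ : p₃ is the minimum
      refine value_le_of_min_le hg h3 (by linarith) ((min_le_right _ _).trans (min_le_right _ _)) ?_
      exact max_le (by linarith) (max_le (by linarith) (by linarith))

/-- **Attainment.**  At the Gibbs point `p = (1 − 2x⋆, x⋆, x⋆)`, `x⋆ = 1/(g² + 1)`, `g ≥ 2`, the value equals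
`log(g² + 1)`; so `sup_p Φ_g(p) = log(g² + 1)` exactly. [cite: CoverThomas2006, Thm. 2.6.3] -/
theorem levelOneValue_eq_at_gibbsPoint {g : ℝ} (hg : 2 ≤ g) :
    min (Real.binEntropy (1 - 2 * (1 / (g ^ 2 + 1))))
        (min (Real.binEntropy (1 / (g ^ 2 + 1))) (Real.binEntropy (1 / (g ^ 2 + 1))))
      + (1 + max (1 - 2 * (1 / (g ^ 2 + 1))) (max (1 / (g ^ 2 + 1)) (1 / (g ^ 2 + 1)))) * Real.log g
      = Real.log (g ^ 2 + 1) := by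
  set x : ℝ := 1 / (g ^ 2 + 1) with hx
  have hg2 : 4 ≤ g ^ 2 := by nlinarith
  have hx0 : 0 < x := by positivity
  have hx4 : x ≤ 1 / 5 := by
    rw [hx, div_le_div_iff₀ (by positivity) (by norm_num)]
    linarith
  -- `h(1 − 2x) = h(2x) ≥ h(x)` since `x ≤ 2x ≤ 1/2`
  have hsymm : Real.binEntropy (1 - 2 * x) = Real.binEntropy (2 * x) := Real.binEntropy_one_sub _
  have hmono : Real.binEntropy x ≤ Real.binEntropy (2 * x) := by
    have hxI : x ∈ Set.Icc (0 : ℝ) 2⁻¹ := ⟨hx0.le, by norm_num at hx4 ⊢; linarith⟩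
    have h2xI : 2 * x ∈ Set.Icc (0 : ℝ) 2⁻¹ := ⟨by linarith, by norm_num at hx4 ⊢; linarith⟩
    exact Real.binEntropy_strictMonoOn.monotoneOn hxI h2xI (by linarith)
  have hmin : min (Real.binEntropy (1 - 2 * x)) (min (Real.binEntropy x) (Real.binEntropy x))
      = Real.binEntropy x := by
    rw [min_self, hsymm, min_eq_right hmono]
  have hmax : max (1 - 2 * x) (max x x) = 1 - 2 * x := by
    rw [max_self, max_eq_left (by linarith)]
  rw [hmin, hmax]
  have h := binEntropy_add_two_mul_log_eq (g := g) (by linarith)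
  rw [← hx] at h
  have : (1 + (1 - 2 * x)) = (2 - 2 * x) := by ring
  rw [this]
  exact h

/-- `log(g² + 1) < log(g² + g) = log R̲(T_(g))` for `g > 1`. [folklore] -/
theorem log_sq_add_one_lt_log_borderRank {g : ℝ} (hg : 1 < g) :
    Real.log (g ^ 2 + 1) < Real.log (g ^ 2 + g) :=
  Real.log_lt_log (by positivity) (by linarith)

/-- **No exactly tight shape at level 1.**  For `g > 1` and every law `p` on the three blocks,
`min_i h(p_i) + (1 + max_i p_i)·log g < log(g² + g)`: the first-power certificate of the coarse blocking of
`T_(g)` stays a definite `log((g² + g)/(g² + 1))` per coordinate above the flattening bound at every type, so it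
certifies no thin tight point `ω(1,t,r) = 1 + r` (the currency of crux `SubexpSaturation`).
[cite: CoppersmithWinograd1990, §6] [cite: JelisiejewLandsbergPal2023, §1.4.1] -/
theorem levelOneValue_lt_log_borderRank {g p₁ p₂ p₃ : ℝ} (hg : 1 < g) (h1 : 0 ≤ p₁) (h2 : 0 ≤ p₂)
    (h3 : 0 ≤ p₃) (hs : p₁ + p₂ + p₃ = 1) :
    min (Real.binEntropy p₁) (min (Real.binEntropy p₂) (Real.binEntropy p₃))
      + (1 + max p₁ (max p₂ p₃)) * Real.log g < Real.log (g ^ 2 + g) :=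
  (levelOneValue_le hg.le h1 h2 h3 hs).trans_lt (log_sq_add_one_lt_log_borderRank hg)

/-- The uniform defect is positive: `0 < log((g² + g)/(g² + 1))` for `g > 1`. [folklore] -/
theorem defect_pos {g : ℝ} (hg : 1 < g) : 0 < Real.log ((g ^ 2 + g) / (g ^ 2 + 1)) := by
  apply Real.log_pos
  rw [lt_div_iff₀ (by positivity)]
  linarith

/-- **Shape geometry of matrix–vector blocks.**  The pair sums `e = p₁ + p₃`, `h = p₁ + p₂`, `l = p₂ + p₃` of
nonnegative reals are BALANCED: twice the largest is at most the total. [folklore] -/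
theorem pairSums_max_le_half {p₁ p₂ p₃ : ℝ} (h1 : 0 ≤ p₁) (h2 : 0 ≤ p₂) (h3 : 0 ≤ p₃) :
    2 * max (p₁ + p₃) (max (p₁ + p₂) (p₂ + p₃)) ≤ (p₁ + p₃) + (p₁ + p₂) + (p₂ + p₃) := by
  rcases max_cases (p₁ + p₂) (p₂ + p₃) with ⟨hm, _⟩ | ⟨hm, _⟩ <;>
    rcases max_cases (p₁ + p₃) (max (p₁ + p₂) (p₂ + p₃)) with ⟨hm', _⟩ | ⟨hm', _⟩ <;>
    simp only [hm'] <;> (try simp only [hm]) <;> linarith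

/-- … whereas a FAR thin shape `s·(1, t, r)` with `r > 1 + t` (`s > 0`) is unbalanced: twice its largest entry
exceeds the total.  Hence no law `p` realises a far thin shape through the pair sums, in any order of the legs
(the maximum of a triple does not depend on the order). [folklore] -/
theorem thin_far_not_balanced {s t r : ℝ} (hs : 0 < s) (hfar : 1 + t < r) :
    s + s * t + s * r < 2 * (s * r) := by nlinarith

/-- Corollary (unreachability, legs in the displayed order): if the pair sums of a nonnegative law equal a far thin
shape `(s, s t, s r)` with `r > 1 + t`, `s > 0` — contradiction. [folklore] -/
theorem pairSums_ne_far_shape {p₁ p₂ p₃ s t r : ℝ} (h1 : 0 ≤ p₁) (h2 : 0 ≤ p₂) (h3 : 0 ≤ p₃) (hs : 0 < s)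
    (hfar : 1 + t < r)
    (he : p₁ + p₃ = s) (hh : p₁ + p₂ = s * t) (hl : p₂ + p₃ = s * r) : False := by
  have hb := pairSums_max_le_half h1 h2 h3
  have hu := thin_far_not_balanced hs hfar
  have hr : s * r ≤ max (p₁ + p₃) (max (p₁ + p₂) (p₂ + p₃)) := by
    rw [← hl]; exact le_trans (le_max_right _ _) (le_max_right _ _)
  rw [he, hh, hl] at hb
  linarith

end Summit.MatrixMultiplication.MatrixMultiplication.Theorems.SaturationLadderMatrixVectorGibbs
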